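import Summits.RiemannHypothesis.RiemannHypothesis.Theses.SpectralTrace
import Summits.RiemannHypothesis.RiemannHypothesis.Cruxes.SpectralIsHpSpectrum.Disproof
import Summits.RiemannHypothesis.RiemannHypothesis.Theorems.WindowTraceArch.Negative.LocalWeyl
import Summits.RiemannHypothesis.RiemannHypothesis.Theorems.WindowTraceArch.Negative.ComplexSpectrum
import Summits.RiemannHypothesis.RiemannHypothesis.Theorems.SpectralIsHpSpectrum.Negative.RefutationImpliesRH
import Literature.NumberTheory.LFunctions.WeilMellinBounds
import Literature.NumberTheory.LFunctions.WeilArchimedeanPositivityProofs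
import HarnessLib

/-!
# Line `dilation-peak-local-weyl` — skeleton for the crux `SpectralIsHpSpectrum`
(stmt-RiemannHypothesis-0195, route `SpectralTrace`) · crux-plan GEN 2 (2026-08-16T03:45Z)

Crux (by name): `Summit.RiemannHypothesis.RiemannHypothesis.Theses.SpectralTrace.SpectralIsHpSpectrum` —
every real family `γ` reproducing the Weil functional `W` on all Weil tests has, over every `z`,
fibre count = multiplicity of `z` as a non-trivial zero of `ζ`.

Gen 2 = re-plan of the gen-1 skeleton (planner `…dilation-peak-local--0`, 03:31Z) against the CURRENT
`Disproof.lean` (03:01Z) and the gen-2 triage panel (TRIAGE-r1-1/2/3, r1-2 rewritten 03:22Z): the three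
registered stub NAMES AND SIGNATURES ARE UNCHANGED (byte-identical, so the crux's stub registry keeps
one record per stub across generations) and the composition `SpectralIsHpSpectrum_of` is unchanged
(hypotheses = the name-keyed aliases `Registered.stub_*` of the three statements; the D-0027 §3.3
`stub` obligation attribute was tried and is refused by `crux write` as gate-reserved, so the alias is
the seat-side mechanism); the gen-1 `*_holds` lemmas became `example`s (nothing but the three `stub_*` depends on
`sorry`). Documentation is new: sibling complete lines, fallback dominators, landing notes — see the
line card `Lines/dilation-peak-local-weyl.md`. Preflight (this seat, farm): `#h21_check_skeleton` ok,
codes [], closed modulo the three stubs.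

## The line (idea card `Ideas/dilation-peak-local-weyl.md`, triage r1-1/2/3: pass ×2 generations)

Read each multiplicity as a LIMIT of the trace itself. For a Weil test `h`, a frequency `x` and a
scale `R > 0`, the dilated–modulated bump `Q(t) = e^{-ixt} R⁻¹ h(t/R)` has
`Q̂(1/2+iu) = ĥ(1/2 + iR(u-x))` (`weilMellin g (1/2+iu) = ∫ g(t) e^{iut} dt` is the Fourier
transform on the critical line, WeilExplicit.lean:129), so the autocorrelation `P = Q ⋆ Q̃` is a
Weil test with `P̂(1/2+iu) = |ĥ(1/2+iR(u-x))|²` — a PEAK FUNCTION at the single frequency `u = x`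
(STUB 1, `stub_peakTest`). For a trace family, `Σ_i |ĥ(1/2+iR(γ_i-x))|² = Re W(P)`; dividing by
`|ĥ(1/2)|² ≠ 0` gives `Σ_i φ(R(γ_i - x))` with `φ(0) = 1`, `0 ≤ φ(v) ≤ C/(1+v²)`. As `R → ∞`
this tends to `#{i : γ_i = x}` by Tannery's theorem (STUB 3, `stub_peakLimit`), the dominating
series `Σ_i C/(1+(γ_i-x)²)` converging by the LANDED local Weyl law
`card_near_le_log_of_windowTrace` (STUB 2, `stub_localWeylSummable`). The left-hand side
`Re W(P)/|ĥ(1/2)|²` is the SAME real sequence for every trace family, so two trace families have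
the same multiplicity at every `x` (`ncard_fibre_eq_of_isTrace`, PROVED here from the three stubs).
The standing disprover's §1 (`riemannHypothesis_of_isTrace`: the hypothesis proves RH) and §2
(`isTrace_ordinates_of_rh`: the zeta ordinates with multiplicity are a second trace;
`spectralIsHpSpectrum_iff_ordinate_count`: the crux is the ordinate count in `ℤ`) plus the
Σ-fibre count `ncard_zetaOrdinates_fibre` (PROVED here) finish: `SpectralIsHpSpectrum_of`
(kernel-checked composition, no `sorry` outside the three `stub_*`).

## Stubs (registered; sizes are estimates)
* STUB 1 `stub_peakTest` (M): dilation + modulation + autocorrelation stay in the Weil class, with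
  the displayed critical-line transform.
* STUB 2 `stub_localWeylSummable` (M–L, HARDEST — the only stub with arithmetic content): a trace
  family has `Σ_i 1/(1+(γ_i-x)²) < ∞`, from the landed `O(1 + log(1+|T|))` unit-window count.
* STUB 3 `stub_peakLimit` (M): Tannery atom extraction under that dominator.

## Disproof used (`Cruxes/SpectralIsHpSpectrum/Disproof.lean` @ 03:01Z, imported; `-- Targets`: none)
* §3 `spectralIsHpSpectrum_false_without_value` (any proof must use the VALUE `W g`) — HONOURED at
  `hasSum_peak_re` / `ncard_fibre_eq_of_isTrace`: the two peak sums are compared THROUGH the common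
  value `Re W(P)`; STUB 2's dominator is also a consequence of the value (local Weyl law), and STUB
  2 keeps the full-value hypothesis verbatim (never mere `Summable`).
* §3 `spectralIsHpSpectrum_false_on_window_of_nonpos` / §5 window rigidity — HONOURED: STUB 1's
  test `P` has support `2R · supp h → ∞`; nothing is claimed on a fixed window.
* §3 realness / §5 complex spectra — the peak profile `|ĥ(1/2+iR(u-x))|² ≥ 0` is a critical-line
  phenomenon; no stub speaks about complex families. §3 integrality — not used (limits of real
  sequences). §4 all-zeros variant (≡ ¬RH) — untouched: `mult` only via the disprover's §2.
* Landed Negative lemmas of THIS crux (`Theorems/SpectralIsHpSpectrum/Negative/RefutationImpliesRH`,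
  imported; see the closing `example`): `spectralIsHpSpectrum_false_without_value`,
  `spectralIsHpSpectrum_false_on_window_of_nonpos`, `spectralIsHpSpectrumAllZeros_iff_not_riemannHypothesis`
  — no stub is an instance of any of them (STUB 2 keeps the full-value, all-tests hypothesis; STUBS 1/3
  mention neither `W` nor `ζ`). The sibling `WindowTraceArch/Negative/*` lemmas are USED (LocalWeyl,
  ComplexSpectrum), not contradicted.

## Sibling lines (state at gen 2) and reshape options for the lead
* `self-majorant-peak` (ideator 2 g2) and `power-method-projector` (ideator 3 g2) carry COMPLETE
  sorry-free proofs of the crux by name in the crux dir (`SelfMajorantComplete.lean`,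
  `SketchIdeator3g2.lean`); this line is the measure-free POSITIVE-peak alternative whose by-product
  is the `W`-only multiplicity formula `mult(x) = lim_R Re W(P_{x,R}) / |ĥ(1/2)|²`.
* If STUB 2 stalls: (a) fallback finish `fejer-fatou-sandwich` (zero-side dominated limit via
  `summable_norm_zeroSide_of_le` + Fatou + sandwich; keeps STUB 1 and the exit through
  `spectralIsHpSpectrum_iff_ordinate_count`); (b) self-majorant dominator: convolve `P` with one
  fixed Weil test `g` — `|ĝ(1/2+iu)| · ‖Q‖₁²`-type bound, summable BY THE HYPOTHESIS (HasSum in `ℂ`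
  is absolute, `summable_norm_iff`) — which removes STUB 2 at the price of the limit
  `#fibre · |ĥ(1/2)|² · ĝ(1/2+ix)` (then choose `g` with `ĝ(1/2+ix) ≠ 0`). Either reshape keeps
  `SpectralIsHpSpectrum_of`'s architecture (common value → uniqueness of limits → §2).
* Landing note: §2 of the disprover (`spectralIsHpSpectrum_iff_ordinate_count`,
  `isTrace_ordinates_of_rh`) lives in the Cruxes work module imported here; the landed Theorems
  lemma file `Negative/RefutationImpliesRH.lean` has §1/§3/§4 but not §2 — when landing the final
  composition under `Theorems/`, either import this module (if the gate admits Cruxes imports) or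
  land §2 first as a `--supports` file.
-/

noncomputable section

open Complex Set MeasureTheory Filter
open scoped Real Topology

set_option linter.dupNamespace false

namespace Summit.RiemannHypothesis.RiemannHypothesis.Cruxes.SpectralIsHpSpectrum.DilationPeakLocalWeyl

open Literature.NumberTheory.LFunctions
open Summit.RiemannHypothesis.RiemannHypothesis.Theses.SpectralTrace (SpectralIsHpSpectrum)
open Summit.RiemannHypothesis.RiemannHypothesis.Theorems.WindowTraceArch.Negative
open Summit.RiemannHypothesis.RiemannHypothesis.Cruxes.SpectralIsHpSpectrum.Disproof

/-! ### The statements of the line (named `Prop`s over existing declarations; the registered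
`stub_*` theorems below restate them verbatim, the `example`s certify the agreement definitionally,
and the name-keyed aliases `Registered.stub_*` are the hypotheses of the composition — the skeleton
audit admits a `Prop` hypothesis iff its head constant is a tagged obligation or its short name is a
declared stub; the `stub` obligation attribute itself is gate-reserved, so seats use the alias) -/

/-- **STUB 1 statement — the peak test lives in the Weil class.** For every Weil test `h`, every
frequency `x` and every scale `R > 0` there is a Weil test `P` (namely `Q ⋆ Q̃` with
`Q(t) = e^{-ixt} R⁻¹ h(t/R)`) whose transform on the critical line is the peak profile
`P̂(1/2 + iu) = |ĥ(1/2 + iR(u - x))|²`. -/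
def PeakTest : Prop :=
  ∀ h : ℝ → ℂ, IsWeilTest h → ∀ x R : ℝ, 0 < R →
    ∃ P : ℝ → ℂ, IsWeilTest P ∧ ∀ u : ℝ,
      weilMellin P (1 / 2 + u * I) =
        ((‖weilMellin h (1 / 2 + ((R * (u - x) : ℝ) : ℂ) * I)‖ ^ 2 : ℝ) : ℂ)

/-- **STUB 2 statement — local Weyl dominator.** A real family reproducing `W` on all Weil tests
has `Σ_i 1/(1 + (γ_i - x)²) < ∞` for every real `x` (from the landed local Weyl law
`card_near_le_log_of_windowTrace`: `O(1 + log(1+|T|))` points per unit window). -/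
def LocalWeylSummable : Prop :=
  ∀ (ι : Type) (γ : ι → ℝ),
    (∀ g : ℝ → ℂ, IsWeilTest g →
      HasSum (fun i => weilMellin g (1 / 2 + (γ i : ℂ) * I)) (weilFunctional g)) →
    ∀ x : ℝ, Summable fun i => 1 / (1 + (γ i - x) ^ 2)

/-- **STUB 3 statement — Wiener/Tannery atom extraction.** If `Σ_i 1/(1+(γ_i-x)²) < ∞` then for
any profile `φ` with `φ(0) = 1`, `|φ(u)| ≤ C/(1+u²)`, the peak sums `Σ_i φ((n+1)(γ_i - x))` tend
to the (finite) multiplicity `#{i : γ_i = x}` as `n → ∞`. -/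
def PeakLimit : Prop :=
  ∀ (ι : Type) (γ : ι → ℝ) (x : ℝ), (Summable fun i => 1 / (1 + (γ i - x) ^ 2)) →
    ∀ (φ : ℝ → ℝ) (C : ℝ), φ 0 = 1 → (∀ u : ℝ, |φ u| ≤ C / (1 + u ^ 2)) →
      Tendsto (fun n : ℕ => ∑' i, φ ((n + 1 : ℝ) * (γ i - x))) atTop
        (𝓝 ({i | γ i = x}.ncard : ℝ))

/-! ### The registered stubs (the ONLY `sorry`s of this file) -/

/-- **STUB 1 (`stub_peakTest`, size M).** Dilation `(R⁻¹ h(·/R))^(1/2+iu) = ĥ(1/2+iRu)`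
(substitution `t = Rs` in `weilMellin`), modulation `weilMellin_modulate`, autocorrelation
`weilMellin_weilConv_weilReflect_half`; `IsWeilTest` is stable under dilation (`ContDiff.comp`
with a linear map, `HasCompactSupport.comp_homeomorph`), modulation (`isWeilTest_modulate`) and
`⋆`, `~` (`IsWeilTest.weilConv`, `IsWeilTest.weilReflect`). -/
theorem stub_peakTest :
    ∀ h : ℝ → ℂ, IsWeilTest h → ∀ x R : ℝ, 0 < R →
      ∃ P : ℝ → ℂ, IsWeilTest P ∧ ∀ u : ℝ,
        weilMellin P (1 / 2 + u * I) =
          ((‖weilMellin h (1 / 2 + ((R * (u - x) : ℝ) : ℂ) * I)‖ ^ 2 : ℝ) : ℂ) := by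
  sorry

/-- **STUB 2 (`stub_localWeylSummable`, size M–L, judged HARDEST).** From
`card_near_le_log_of_windowTrace one_pos (fun g hg _ => hγ g hg)`: every finset of indices inside a
unit window `[T-1, T+1]` has `≤ C(1 + log(1+|T|))` elements. Bound an arbitrary finset sum
`Σ_{i∈s} 1/(1+(γ_i-x)²)` by sorting `i` into the cells `k = ⌊γ_i - x⌋ ∈ ℤ`:
`≤ Σ_k C(1 + log(2 + |x| + |k|)) / (1 + (max(|k|,1) - 1)²) =: B < ∞`, then
`summable_of_sum_le`. -/
theorem stub_localWeylSummable :
    ∀ (ι : Type) (γ : ι → ℝ),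
      (∀ g : ℝ → ℂ, IsWeilTest g →
        HasSum (fun i => weilMellin g (1 / 2 + (γ i : ℂ) * I)) (weilFunctional g)) →
      ∀ x : ℝ, Summable fun i => 1 / (1 + (γ i - x) ^ 2) := by
  sorry

/-- **STUB 3 (`stub_peakLimit`, size M).** Tannery (`tendsto_tsum_of_dominated_convergence`)
with the `n`-uniform dominator `|φ((n+1)v)| ≤ C/(1+(n+1)²v²) ≤ C/(1+v²)`; termwise limit
`𝟙[γ_i = x]` (`φ(0) = 1`; for `v ≠ 0`, `C/(1+(n+1)²v²) → 0`); the fibre `{i : γ_i = x}` is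
finite because each of its points contributes `1` to the convergent `Σ_i 1/(1+(γ_i-x)²)`, and
`∑' i, 𝟙[γ_i = x] = ncard` (`tsum` of an indicator of a finite set). -/
theorem stub_peakLimit :
    ∀ (ι : Type) (γ : ι → ℝ) (x : ℝ), (Summable fun i => 1 / (1 + (γ i - x) ^ 2)) →
      ∀ (φ : ℝ → ℝ) (C : ℝ), φ 0 = 1 → (∀ u : ℝ, |φ u| ≤ C / (1 + u ^ 2)) →
        Tendsto (fun n : ℕ => ∑' i, φ ((n + 1 : ℝ) * (γ i - x))) atTop
          (𝓝 ({i | γ i = x}.ncard : ℝ)) := by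
  sorry

/-! ### Consistency: each named statement IS its registered stub (definitionally; `example`s, so
no declaration of this file other than the three `stub_*` depends on `sorry`) -/

example : PeakTest := stub_peakTest
example : LocalWeylSummable := stub_localWeylSummable
example : PeakLimit := stub_peakLimit

/-! ### Name-keyed aliases of the three statements (the hypotheses of the composition: the skeleton
audit admits a hypothesis whose head constant's short name is a declared stub) -/
namespace Registered

/-- Alias of `PeakTest` keyed by the registered stub name `stub_peakTest`. -/
abbrev stub_peakTest : Prop := PeakTest
/-- Alias of `LocalWeylSummable` keyed by the registered stub name `stub_localWeylSummable`. -/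
abbrev stub_localWeylSummable : Prop := LocalWeylSummable
/-- Alias of `PeakLimit` keyed by the registered stub name `stub_peakLimit`. -/
abbrev stub_peakLimit : Prop := PeakLimit

end Registered

/-! ### Glue (PROVED) — a peak profile, the common value, the zeta-side count -/

/-- **A peak profile exists**: a Weil test `h` with `ĥ(1/2) ≠ 0` and
`|ĥ(1/2+iv)|² ≤ C/(1+v²)` (narrow bump `exists_isWeilTest_re_weilMellin_pos 0`; decay
`norm_weilMellin_le`, two integrations by parts). -/
theorem exists_peakProfile :
    ∃ h : ℝ → ℂ, IsWeilTest h ∧ weilMellin h (1 / 2) ≠ 0 ∧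
      ∃ C : ℝ, ∀ v : ℝ, ‖weilMellin h (1 / 2 + v * I)‖ ^ 2 ≤ C / (1 + v ^ 2) := by
  obtain ⟨h, hh, hpos⟩ := exists_isWeilTest_re_weilMellin_pos 0
  refine ⟨h, hh, ?_, (weilDecayConst h) ^ 2, fun v => ?_⟩
  · have h0 := hpos (1 / 2)
    have e : ((1 / 2 : ℝ) : ℂ) + ((0 : ℝ) : ℂ) * I = 1 / 2 := by push_cast; ring
    rw [e] at h0
    intro hz
    rw [hz, Complex.zero_re] at h0
    exact lt_irrefl _ h0
  · have hv : 0 < 1 + v ^ 2 := by positivity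
    have h1 : ‖weilMellin h (1 / 2 + v * I)‖ ≤ weilDecayConst h / (1 + v ^ 2) := by
      have := norm_weilMellin_le hh (s := 1 / 2 + v * I) (by simp) (by norm_num)
      simpa using this
    have hC : 0 ≤ weilDecayConst h := weilDecayConst_nonneg h
    have h2 : ‖weilMellin h (1 / 2 + v * I)‖ ^ 2 ≤ (weilDecayConst h / (1 + v ^ 2)) ^ 2 :=
      pow_le_pow_left₀ (norm_nonneg _) h1 2
    have h3 : (weilDecayConst h / (1 + v ^ 2)) ^ 2 ≤ (weilDecayConst h) ^ 2 / (1 + v ^ 2) := by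
      rw [div_pow, div_le_div_iff₀ (by positivity) hv]
      have h4 : (1 + v ^ 2) ≤ (1 + v ^ 2) ^ 2 := by nlinarith [sq_nonneg v]
      have h5 : 0 ≤ weilDecayConst h ^ 2 := sq_nonneg _
      nlinarith
    exact h2.trans h3

/-- **The common value.** For a trace family and a Weil test `P` whose critical-line transform is
the REAL profile `w`, `Σ_i w(γ_i) = Re W(P)` (HasSum). This is where the VALUE of the trace enters
(Disproof §3 `spectralIsHpSpectrum_false_without_value`). -/
theorem hasSum_peak_re {ι : Type*} {γ : ι → ℝ} (hγ : IsTrace γ) {P : ℝ → ℂ} (hP : IsWeilTest P)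
    {w : ℝ → ℝ} (hPu : ∀ u : ℝ, weilMellin P (1 / 2 + u * I) = ((w u : ℝ) : ℂ)) :
    HasSum (fun i => w (γ i)) (weilFunctional P).re := by
  have h := hγ P hP
  simp only [hPu] at h
  simpa only [Complex.reCLM_apply, Complex.ofReal_re] using h.mapL Complex.reCLM

/-- Two trace families have the same normalised peak sums (both equal `Re W(P) / a`). -/
theorem tsum_peak_eq_of_isTrace {ι ι' : Type*} {γ : ι → ℝ} {γ' : ι' → ℝ} (hγ : IsTrace γ)
    (hγ' : IsTrace γ') {P : ℝ → ℂ} (hP : IsWeilTest P) {w : ℝ → ℝ}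
    (hPu : ∀ u : ℝ, weilMellin P (1 / 2 + u * I) = ((w u : ℝ) : ℂ)) (a : ℝ) :
    ∑' i, w (γ i) / a = ∑' j, w (γ' j) / a := by
  rw [((hasSum_peak_re hγ hP hPu).div_const a).tsum_eq,
    ((hasSum_peak_re hγ' hP hPu).div_const a).tsum_eq]

/-- **Multiplicities of two trace families agree** (the transfer `C⁺_W` of the idea card, PROVED
from the three stubs): the peak sums of `γ` and `γ'` are the same real sequence, and STUB 3
identifies its limit as either multiplicity. -/
theorem ncard_fibre_eq_of_isTrace (h₁ : PeakTest) (h₂ : LocalWeylSummable) (h₃ : PeakLimit)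
    {ι ι' : Type} {γ : ι → ℝ} {γ' : ι' → ℝ} (hγ : IsTrace γ) (hγ' : IsTrace γ') (τ : ℝ) :
    {i | γ i = τ}.ncard = {j | γ' j = τ}.ncard := by
  obtain ⟨h, hh, hh0, C, hC⟩ := exists_peakProfile
  have ha : 0 < ‖weilMellin h (1 / 2)‖ ^ 2 := by positivity
  -- the normalised profile `φ(v) = |ĥ(1/2+iv)|² / |ĥ(1/2)|²`
  have hφ0 : (fun v : ℝ => ‖weilMellin h (1 / 2 + (v : ℂ) * I)‖ ^ 2 / ‖weilMellin h (1 / 2)‖ ^ 2) 0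
      = 1 := by
    simp only [Complex.ofReal_zero, zero_mul, add_zero]
    exact div_self ha.ne'
  have hφ : ∀ u : ℝ,
      |(fun v : ℝ => ‖weilMellin h (1 / 2 + (v : ℂ) * I)‖ ^ 2 / ‖weilMellin h (1 / 2)‖ ^ 2) u| ≤
        (C / ‖weilMellin h (1 / 2)‖ ^ 2) / (1 + u ^ 2) := by
    intro u
    simp only
    rw [abs_of_nonneg (by positivity), div_right_comm C]
    exact div_le_div_of_nonneg_right (hC u) ha.le
  have hlim := h₃ ι γ τ (h₂ ι γ hγ τ) _ _ hφ0 hφ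
  have hlim' := h₃ ι' γ' τ (h₂ ι' γ' hγ' τ) _ _ hφ0 hφ
  have heq : (fun n : ℕ => ∑' i, (fun v : ℝ => ‖weilMellin h (1 / 2 + (v : ℂ) * I)‖ ^ 2 /
      ‖weilMellin h (1 / 2)‖ ^ 2) ((n + 1 : ℝ) * (γ i - τ))) =
      fun n : ℕ => ∑' j, (fun v : ℝ => ‖weilMellin h (1 / 2 + (v : ℂ) * I)‖ ^ 2 /
        ‖weilMellin h (1 / 2)‖ ^ 2) ((n + 1 : ℝ) * (γ' j - τ)) := by
    funext n
    obtain ⟨P, hP, hPu⟩ := h₁ h hh τ (n + 1) (by positivity)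
    exact tsum_peak_eq_of_isTrace hγ hγ' hP
      (w := fun u : ℝ => ‖weilMellin h (1 / 2 + (((n + 1 : ℝ) * (u - τ) : ℝ) : ℂ) * I)‖ ^ 2) hPu _
  rw [heq] at hlim
  exact_mod_cast tendsto_nhds_unique hlim hlim'

/-- The canonical real spectrum under RH: ordinates of the non-trivial zeros repeated with
multiplicity (index type of `hasSum_weilMellin_zeros`; a trace by `isTrace_ordinates_of_rh`). -/
def zetaOrdinates :
    (Σ ρ : ZetaZeros.riemannZetaNontrivialZeros, Fin (riemannZetaZeroOrder (ρ : ℂ)).toNat) → ℝ :=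
  fun p => (p.1 : ℂ).im

/-- **Fibre count of the canonical family**: `#{p : Im ρ_p = τ} = m(1/2 + iτ)` under RH
(crux-ideate round 1, ideator 1, `SketchIdeator1.lean`; re-proved verbatim against `Disproof`). -/
theorem ncard_zetaOrdinates_fibre (hRH : _root_.RiemannHypothesis) (τ : ℝ) :
    (({p | zetaOrdinates p = τ}.ncard : ℕ) : ℤ) = riemannZetaZeroOrder (1 / 2 + τ * I) := by
  set s : ℂ := 1 / 2 + τ * I with hs_def
  have hs1 : s ≠ 1 := half_add_ne_one τ
  by_cases hz : s ∈ ZetaZeros.riemannZetaNontrivialZeros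
  · have hset : {p : (Σ ρ : ZetaZeros.riemannZetaNontrivialZeros,
        Fin (riemannZetaZeroOrder (ρ : ℂ)).toNat) | zetaOrdinates p = τ} =
        Set.range (Sigma.mk (β := fun ρ : ZetaZeros.riemannZetaNontrivialZeros =>
          Fin (riemannZetaZeroOrder (ρ : ℂ)).toNat) ⟨s, hz⟩) := by
      ext p
      simp only [Set.mem_setOf_eq, Set.mem_range, zetaOrdinates]
      constructor
      · intro hp
        obtain ⟨ρ, c⟩ := p
        have hρ : ρ = ⟨s, hz⟩ := by
          apply Subtype.ext
          have h1 := eq_half_add_of_riemannHypothesis hRH ρ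
          simp only at hp
          rw [← h1, hp]
        subst hρ
        exact ⟨c, rfl⟩
      · rintro ⟨c, rfl⟩
        simp [hs_def]
    rw [hset, Set.ncard_range_of_injective sigma_mk_injective, Nat.card_eq_fintype_card,
      Fintype.card_fin]
    have h1 := ZetaZeros.riemannZetaNontrivialZeros.one_le_order hz
    change (((riemannZetaZeroOrder s).toNat : ℕ) : ℤ) = riemannZetaZeroOrder s
    exact Int.toNat_of_nonneg (by omega)
  · have hset : {p : (Σ ρ : ZetaZeros.riemannZetaNontrivialZeros,
        Fin (riemannZetaZeroOrder (ρ : ℂ)).toNat) | zetaOrdinates p = τ} = ∅ := by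
      ext p
      simp only [Set.mem_setOf_eq, Set.mem_empty_iff_false, iff_false, zetaOrdinates]
      intro hp
      apply hz
      have h1 := eq_half_add_of_riemannHypothesis hRH p.1
      rw [hp] at h1
      rw [hs_def, h1]
      exact p.1.2
    rw [hset, Set.ncard_empty]
    have h0 : ¬ 0 < riemannZetaZeroOrder s := by
      rw [riemannZetaZeroOrder_pos_iff hs1]
      intro hζ
      exact hz (ZetaZeros.riemannZetaNontrivialZeros.mem_of_re_pos hζ (by simp [hs_def]))
    have h2 := riemannZetaZeroOrder_nonneg hs1
    push_cast
    omega

/-! ### The composition: the three stubs prove the crux BY NAME -/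

/-- **`SpectralIsHpSpectrum_of`** — kernel-checked composition (no `sorry` of its own): by the
disprover's §2 the crux is the ordinate count `#{i : γ_i = τ} = m(1/2+iτ)` in `ℤ`; the hypothesis
gives RH (§1), so the zeta ordinates are a second trace (`isTrace_ordinates_of_rh`); the two traces
have equal multiplicities (`ncard_fibre_eq_of_isTrace`, from the stubs), and the zeta side counts
`m(1/2+iτ)` (`ncard_zetaOrdinates_fibre`). -/
theorem SpectralIsHpSpectrum_of (h₁ : Registered.stub_peakTest)
    (h₂ : Registered.stub_localWeylSummable) (h₃ : Registered.stub_peakLimit) :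
    Summit.RiemannHypothesis.RiemannHypothesis.Theses.SpectralTrace.SpectralIsHpSpectrum := by
  rw [spectralIsHpSpectrum_iff_ordinate_count]
  intro ι γ hγ τ
  have hRH : _root_.RiemannHypothesis := riemannHypothesis_of_isTrace hγ
  have hZ : IsTrace zetaOrdinates := isTrace_ordinates_of_rh hRH
  rw [ncard_fibre_eq_of_isTrace h₁ h₂ h₃ hγ hZ τ]
  exact ncard_zetaOrdinates_fibre hRH τ

/-- Wiring check: the registered stubs feed `SpectralIsHpSpectrum_of` exactly as stated. -/
example : Summit.RiemannHypothesis.RiemannHypothesis.Theses.SpectralTrace.SpectralIsHpSpectrum :=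
  SpectralIsHpSpectrum_of stub_peakTest stub_localWeylSummable stub_peakLimit

/-! ### Checked against the landed Negative lemmas of this crux
(`Theorems/SpectralIsHpSpectrum/Negative/RefutationImpliesRH.lean`, imported): STUB 2's hypothesis is
the full-VALUE trace — `riemannHypothesis_of_trace` applies to it verbatim — and not the refuted
value-free weakening of `spectralIsHpSpectrum_false_without_value`; no stub restricts the tests to
a window (`spectralIsHpSpectrum_false_on_window_of_nonpos`); STUBS 1 and 3 do not mention `W` or
`ζ` at all. -/

example {ι : Type} {γ : ι → ℝ}
    (hγ : ∀ g : ℝ → ℂ, IsWeilTest g →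
      HasSum (fun i => weilMellin g (1 / 2 + (γ i : ℂ) * I)) (weilFunctional g)) :
    _root_.RiemannHypothesis :=
  Summit.RiemannHypothesis.RiemannHypothesis.Theorems.SpectralIsHpSpectrum.Negative.riemannHypothesis_of_trace
    hγ

end Summit.RiemannHypothesis.RiemannHypothesis.Cruxes.SpectralIsHpSpectrum.DilationPeakLocalWeyl

end
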